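import Mathlib
import Summits.Ventures.PercRepro2.TypedFactor
import Summits.Ventures.PercRepro2.OneTypedEdge
import Summits.Ventures.PercRepro2.TypedSpectator

/-!
# The separated class of row 2′TRI, I: sides, support states, the kernel identity and the
factorisation tools (blind cell PercRepro2, p3 g0, 2026-08-25; sub-claim S2 of
`proofs/CRUX-SUBCLAIMS.md`, paper proof `proofs/subclaims/S2-SEPARATED.md`; the definitions
`zF` / `FL` / `Sep` / `sepSt` and the lemmas `disjoint_FL`, `cluster_a1_restr`, `KB_sepSt` are
night-3 g5's skeleton `mining/night-3/g5/SeparatedSkeleton.lean`, NIGHT3-CERT.md §14.4 / §14.6)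

An instance `(F, z, τ)` of the typed three-copy count of `K₃` is SEPARATED (`Sep`) when
`a₁ ↮ a₂` in `z ∪ F` (`zF`, every typed edge open).  Its typed edges split into the `l`-side
`FL a₁` (touching the component of `a₁` in `z ∪ F`), the `h`-side `FL a₂` and an inert rest; the
two sides are disjoint (`disjoint_FL`) and, on the support (copies agreeing with `z` off `F`), the
cluster of a root only depends on its side's typed edges (`cluster_a1_restr`, domain Markov), so
`1[v ∈ C(a₁)]` / `1[v ∈ C(a₂)]` factor through the side restrictions (`iL_restr` / `iH_restr`).
In the placement `o, b` on the `l`-side and `a₃` on the `h`-side every copy on the support has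
the separated state `(q′, L_o, H_o, L_b, H_b, L₃, H₃) = (0, L_o, 0, L_b, 0, 0, H₃)` (`st_eq_sepSt`),
and `K₃` is the eight-term polynomial `KB_sepSt` (`decide`, 512 triples) in `L_o, L_b, H₃` of the
three copies (`K3_eq_sepPoly`).  The counting tools: `typedCount` only sees the kernel on the
support (`typedCount_congr_support`), six-term linearity (`typedCount_expand6`), and the
factorisation of a product kernel over disjoint typed-edge sets (`rprod`, `typedCount_rprod`,
`typedCount_eq_mul_inert` — from `TypedFactor.typedCount_mul_of_disjoint`).  Part II
(`SeparatedClass.lean`) assembles the identity `N = 2 · A_H · (S_same − S_cross) · (inert count)`.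
Own work; imports only Mathlib and the cell's prefix; standard axioms.
-/

namespace Summit.Ventures.PercRepro2

open UnionCluster

namespace CovForm

namespace Separated

open OneTyped TypedA3 TypedFactor

section Sides

open Classical

variable {V : Type*} {E : Type*} [Fintype E] [DecidableEq E]

/-- The configuration `z ∪ F` (every typed edge open). -/
def zF (F : Finset E) (z : Config E) : Config E := fun e => z e || decide (e ∈ F)

/-- The `l`-side typed edges: those touching the component of `a₁` in `z ∪ F`. -/
noncomputable def FL (ends : E → Sym2 V) (a₁ : V) (F : Finset E) (z : Config E) : Finset E :=
  F.filter fun e => e ∈ touches ends (cluster ends (zF F z) a₁)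

/-- **Separated instance**: `a₁ ↮ a₂` in `z ∪ F`. -/
def Sep (ends : E → Sym2 V) (a₁ a₂ : V) (F : Finset E) (z : Config E) : Prop :=
  ¬ Conn ends (zF F z) a₂ a₁

omit [Fintype E] in
/-- The side edges are typed edges. -/
lemma FL_subset (ends : E → Sym2 V) (a₁ : V) (F : Finset E) (z : Config E) :
    FL ends a₁ F z ⊆ F :=
  Finset.filter_subset _ _

omit [Fintype E] in
/-- A configuration agreeing with `z` off `F` lies below `z ∪ F`. -/
lemma le_zF (F : Finset E) (z : Config E) {x : Config E} (hx : ∀ e, e ∉ F → x e = z e) :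
    x ≤ zF F z := by
  intro e
  by_cases he : e ∈ F
  · simp [zF, he]
  · by_cases hz : z e = true <;> simp [zF, hx e he, hz]

omit [Fintype E] in
/-- The two sides' typed edges are disjoint: an edge of `F` touching both components would join
them in `z ∪ F`. -/
lemma disjoint_FL (ends : E → Sym2 V) (a₁ a₂ : V) (F : Finset E) (z : Config E)
    (h : Sep ends a₁ a₂ F z) : Disjoint (FL ends a₁ F z) (FL ends a₂ F z) := by
  rw [Finset.disjoint_left]
  intro e h1 h2
  simp only [FL, Finset.mem_filter] at h1 h2
  obtain ⟨heF, u, hu, v, huv⟩ := h1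
  obtain ⟨_, u', hu', v', huv'⟩ := h2
  have hopen : zF F z e = true := by simp [zF, heF]
  have hadj : Conn ends (zF F z) u v := conn_of_openAdj ⟨e, hopen, huv⟩
  rw [mem_cluster] at hu hu'
  -- `u'` is `u` or `v`, both in the cluster of `a₁`
  have hu'1 : Conn ends (zF F z) a₁ u' := by
    rw [huv, Sym2.eq_iff] at huv'
    rcases huv' with ⟨h1, _⟩ | ⟨_, h2⟩
    · exact h1 ▸ hu
    · exact h2 ▸ conn_trans hu hadj
  exact h (conn_trans hu' (conn_symm hu'1))

omit [Fintype E] in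
/-- Domain Markov on the support (`cluster_eq_of_eqOn_touches`): the cluster of `a₁` only depends
on the `l`-side typed edges, `cluster ends x a₁ = cluster ends (restr (FL …) z x) a₁`. -/
lemma cluster_a1_restr (ends : E → Sym2 V) (a₁ : V) (F : Finset E) (z : Config E)
    {x : Config E} (hx : ∀ e, e ∉ F → x e = z e) :
    cluster ends x a₁ = cluster ends (restr (FL ends a₁ F z) z x) a₁ := by
  have hsub : cluster ends x a₁ ⊆ cluster ends (zF F z) a₁ := cluster_mono (le_zF F z hx) a₁
  symm
  refine cluster_eq_of_eqOn_touches (ω := x) (ω' := restr (FL ends a₁ F z) z x) ?_ rfl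
  intro e he
  by_cases heF : e ∈ F
  · have heL : e ∈ FL ends a₁ F z := by
      simp only [FL, Finset.mem_filter]
      refine ⟨heF, ?_⟩
      obtain ⟨u, hu, v, huv⟩ := he
      exact ⟨u, hsub hu, v, huv⟩
    rw [restr_of_mem heL]
  · have heL : e ∉ FL ends a₁ F z := by
      simp only [FL, Finset.mem_filter, not_and]
      intro h; exact absurd h heF
    rw [restr_of_not_mem heL, hx e heF]

omit [Fintype E] in
/-- Restricting to a subset of the typed edges twice is restricting once. -/
lemma restr_restr_of_subset {A B : Finset E} (h : A ⊆ B) (z x : Config E) :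
    restr A z (restr B z x) = restr A z x := by
  funext e
  by_cases he : e ∈ A
  · simp [restr, he, h he]
  · simp [restr, he]

end Sides

/-! ## The support of a separated instance: connections and the side indicators -/

section Support

open Classical

variable {V : Type*} {E : Type*} [Fintype E] [DecidableEq E]

omit [Fintype E] in
/-- On the support of a separated instance no copy joins `a₂` to `a₁`. -/
lemma not_conn_roots (ends : E → Sym2 V) (a₁ a₂ : V) (F : Finset E) (z : Config E)
    (hsep : Sep ends a₁ a₂ F z) {x : Config E} (hx : ∀ e, e ∉ F → x e = z e) :
    ¬ Conn ends x a₂ a₁ :=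
  fun h => hsep (conn_mono (le_zF F z hx) h)

omit [Fintype E] in
/-- On the support, a vertex of the `l`-side is not in the cluster of `a₂`. -/
lemma not_conn_a2_of_lside (ends : E → Sym2 V) (a₁ a₂ v : V) (F : Finset E) (z : Config E)
    (hsep : Sep ends a₁ a₂ F z) (hv : v ∈ cluster ends (zF F z) a₁) {x : Config E}
    (hx : ∀ e, e ∉ F → x e = z e) : ¬ Conn ends x a₂ v :=
  fun h => hsep (conn_trans (conn_mono (le_zF F z hx) h) (conn_symm (mem_cluster.1 hv)))

omit [Fintype E] in
/-- On the support, a vertex of the `h`-side is not in the cluster of `a₁`. -/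
lemma not_conn_a1_of_hside (ends : E → Sym2 V) (a₁ a₂ v : V) (F : Finset E) (z : Config E)
    (hsep : Sep ends a₁ a₂ F z) (hv : v ∈ cluster ends (zF F z) a₂) {x : Config E}
    (hx : ∀ e, e ∉ F → x e = z e) : ¬ Conn ends x a₁ v :=
  fun h => hsep (conn_trans (mem_cluster.1 hv) (conn_symm (conn_mono (le_zF F z hx) h)))

omit [Fintype E] in
/-- On the support, `1[v ∈ C(a₁)]` only sees the `l`-side typed edges. -/
lemma iL_restr {R : Type*} [Field R] (ends : E → Sym2 V) (a₁ : V) (F : Finset E) (z : Config E)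
    {x : Config E} (hx : ∀ e, e ∉ F → x e = z e) (v : V) :
    iL ends a₁ v (restr (FL ends a₁ F z) z x) = (iL ends a₁ v x : R) := by
  have h : Conn ends (restr (FL ends a₁ F z) z x) a₁ v ↔ Conn ends x a₁ v := by
    rw [← mem_cluster, ← mem_cluster, ← cluster_a1_restr ends a₁ F z hx]
  unfold iL
  rw [Set.indicator_apply, Set.indicator_apply]
  simp only [mem_connEvent, Pi.one_apply]
  exact if_congr h rfl rfl

omit [Fintype E] in
/-- On the support, `1[v ∈ C(a₂)]` only sees the `h`-side typed edges. -/
lemma iH_restr {R : Type*} [Field R] (ends : E → Sym2 V) (a₂ : V) (F : Finset E) (z : Config E)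
    {x : Config E} (hx : ∀ e, e ∉ F → x e = z e) (v : V) :
    iH ends a₂ v (restr (FL ends a₂ F z) z x) = (iH ends a₂ v x : R) := by
  have h : Conn ends (restr (FL ends a₂ F z) z x) a₂ v ↔ Conn ends x a₂ v := by
    rw [← mem_cluster, ← mem_cluster, ← cluster_a1_restr ends a₂ F z hx]
  unfold iH
  rw [Set.indicator_apply, Set.indicator_apply]
  simp only [mem_connEvent, Pi.one_apply]
  exact if_congr h rfl rfl

end Support

/-! ## The kernel on separated states -/

section Kernel

/-- The `l`-side data of a state: `(L_o, L_b)`; the `h`-side data: `H₃` (separated case (ii):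
`o, b` on the `l`-side, `a₃` on the `h`-side, so `q′ = L₃ = H_o = H_b = false`). -/
def sepSt (Lo Lb H3 : Bool) : St := (false, Lo, false, Lb, false, false, H3)

/-- On separated states the kernel is the eight-term polynomial
`2 P̄(x) H₃(w) L_bL_o(w) − P̄(x) L_b(y) L_o(w) (1 + H₃(w)) − P̄L_o(y) L_bH₃(w) + P̄L_o(x) L_b(y) H₃(w)
+ P̄L_b(y) P̄L_o(w)`, `P̄ = 1 − H₃` (`decide`, 512 triples). -/
theorem KB_sepSt (Lox Lbx H3x Loy Lby H3y Low Lbw H3w : Bool) :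
    KB (sepSt Lox Lbx H3x) (sepSt Loy Lby H3y) (sepSt Low Lbw H3w) =
      2 * (1 - H3x.toNat) * H3w.toNat * (Lbw.toNat * Low.toNat)
        - (1 - H3x.toNat) * Lby.toNat * Low.toNat * (1 + H3w.toNat)
        - (1 - H3y.toNat) * Loy.toNat * (Lbw.toNat * H3w.toNat)
        + (1 - H3x.toNat) * Lox.toNat * Lby.toNat * H3w.toNat
        + (1 - H3y.toNat) * Lby.toNat * ((1 - H3w.toNat) * Low.toNat) := by
  revert Lox Lbx H3x Loy Lby H3y Low Lbw H3w
  decide +kernel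

/-- The eight-term polynomial of `KB_sepSt` over a field, in the indicators
`L_o, L_b, H₃` of the three copies (`P̄ = 1 − H₃`; `L_b(x)` does not occur). -/
def sepPoly {R : Type*} [Field R] (Lox H3x Loy Lby H3y Low Lbw H3w : R) : R :=
  2 * (1 - H3x) * H3w * (Lbw * Low) - (1 - H3x) * Lby * Low * (1 + H3w)
    - (1 - H3y) * Loy * (Lbw * H3w) + (1 - H3x) * Lox * Lby * H3w
    + (1 - H3y) * Lby * ((1 - H3w) * Low)

end Kernel

/-! ## `K₃` on the support of a separated instance -/

section Pointwise

open Classical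

variable {V : Type*} {E : Type*} [Fintype E] [DecidableEq E] {R : Type*} [Field R]
variable (ends : E → Sym2 V) (o a₁ a₂ a₃ b : V)

omit [Fintype E] [DecidableEq E] in
/-- `1[v ∈ C(a₁)]` as the cast of `(decide (a₁ ↔ v)).toNat`. -/
lemma iL_eq_toNat (v : V) (ω : Config E) :
    iL ends a₁ v ω = (((decide (Conn ends ω a₁ v)).toNat : ℤ) : R) := by
  rw [iL_eq_dec]
  by_cases h : Conn ends ω a₁ v <;> simp [h]

omit [Fintype E] [DecidableEq E] in
/-- `1[v ∈ C(a₂)]` as the cast of `(decide (a₂ ↔ v)).toNat`. -/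
lemma iH_eq_toNat (v : V) (ω : Config E) :
    iH ends a₂ v ω = (((decide (Conn ends ω a₂ v)).toNat : ℤ) : R) := by
  rw [iH_eq_dec]
  by_cases h : Conn ends ω a₂ v <;> simp [h]

omit [Fintype E] in
/-- On the support of a separated case-(ii) instance every copy has a separated state. -/
lemma st_eq_sepSt {F : Finset E} {z : Config E} (hsep : Sep ends a₁ a₂ F z)
    (ho : o ∈ cluster ends (zF F z) a₁) (hb : b ∈ cluster ends (zF F z) a₁)
    (h3 : a₃ ∈ cluster ends (zF F z) a₂) {x : Config E} (hx : ∀ e, e ∉ F → x e = z e) :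
    st ends o a₁ a₂ a₃ b x =
      sepSt (decide (Conn ends x a₁ o)) (decide (Conn ends x a₁ b))
        (decide (Conn ends x a₂ a₃)) := by
  have h1 := not_conn_roots ends a₁ a₂ F z hsep hx
  have h2 := not_conn_a2_of_lside ends a₁ a₂ o F z hsep ho hx
  have h3' := not_conn_a2_of_lside ends a₁ a₂ b F z hsep hb hx
  have h4 := not_conn_a1_of_hside ends a₁ a₂ a₃ F z hsep h3 hx
  unfold st sepSt
  rw [decide_eq_false h1, decide_eq_false h2, decide_eq_false h3', decide_eq_false h4]

omit [Fintype E] in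
/-- **`K₃` on the support of a separated case-(ii) instance** is the eight-term polynomial in
`L_o = 1[o ∈ C(a₁)]`, `L_b = 1[b ∈ C(a₁)]` and `H₃ = 1[a₃ ∈ C(a₂)]` of the three copies. -/
lemma K3_eq_sepPoly {F : Finset E} {z : Config E} (hsep : Sep ends a₁ a₂ F z)
    (ho : o ∈ cluster ends (zF F z) a₁) (hb : b ∈ cluster ends (zF F z) a₁)
    (h3 : a₃ ∈ cluster ends (zF F z) a₂) {x y w : Config E} (hx : ∀ e, e ∉ F → x e = z e)
    (hy : ∀ e, e ∉ F → y e = z e) (hw : ∀ e, e ∉ F → w e = z e) :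
    (K3 ends o a₁ a₂ a₃ b x y w : R) =
      sepPoly (iL ends a₁ o x) (iH ends a₂ a₃ x) (iL ends a₁ o y) (iL ends a₁ b y)
        (iH ends a₂ a₃ y) (iL ends a₁ o w) (iL ends a₁ b w) (iH ends a₂ a₃ w) := by
  rw [K3_eq_KB, st_eq_sepSt ends o a₁ a₂ a₃ b hsep ho hb h3 hx,
    st_eq_sepSt ends o a₁ a₂ a₃ b hsep ho hb h3 hy,
    st_eq_sepSt ends o a₁ a₂ a₃ b hsep ho hb h3 hw, KB_sepSt]
  simp only [sepPoly, iL_eq_toNat, iH_eq_toNat]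
  push_cast
  ring

end Pointwise

/-! ## Linearity and factorisation of typed counts -/

section Factor

open Classical

variable {V : Type*} {E : Type*} [Fintype E] [DecidableEq E] {R : Type*} [Field R]

/-- `typedCount` only sees the kernel on the support (triples agreeing with `z` off `F`). -/
lemma typedCount_congr_support (F : Finset E) (z : Config E) (τ : E → ℕ)
    {K K' : Config E → Config E → Config E → R}
    (h : ∀ x y w, (∀ e, e ∉ F → x e = z e) → (∀ e, e ∉ F → y e = z e) →
      (∀ e, e ∉ F → w e = z e) → K x y w = K' x y w) :
    typedCount F z τ K = typedCount F z τ K' := by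
  unfold typedCount
  refine Finset.sum_congr rfl fun x _ => Finset.sum_congr rfl fun y _ =>
    Finset.sum_congr rfl fun w _ => ?_
  split_ifs with hc
  · exact h x y w (fun e he => (hc.1 e he).1) (fun e he => (hc.1 e he).2.1)
      (fun e he => (hc.1 e he).2.2)
  · rfl

/-- Six-term linearity of the typed count. -/
lemma typedCount_expand6 (F : Finset E) (z : Config E) (τ : E → ℕ)
    (P₁ P₂ P₃ P₄ P₅ P₆ : Config E → Config E → Config E → R) :
    typedCount F z τ (fun x y w =>
        2 * P₁ x y w - P₂ x y w - P₃ x y w - P₄ x y w + P₅ x y w + P₆ x y w) =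
      2 * typedCount F z τ P₁ - typedCount F z τ P₂ - typedCount F z τ P₃ -
        typedCount F z τ P₄ + typedCount F z τ P₅ + typedCount F z τ P₆ := by
  simp only [typedCount_eq_sum_cond]
  have key : ∀ x y w : Config E,
      (if cond F z τ x y w then 2 * P₁ x y w - P₂ x y w - P₃ x y w - P₄ x y w + P₅ x y w + P₆ x y w
        else 0) =
      2 * (if cond F z τ x y w then P₁ x y w else 0) - (if cond F z τ x y w then P₂ x y w else 0)
        - (if cond F z τ x y w then P₃ x y w else 0) - (if cond F z τ x y w then P₄ x y w else 0)
        + (if cond F z τ x y w then P₅ x y w else 0)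
        + (if cond F z τ x y w then P₆ x y w else 0) := by
    intro x y w
    split_ifs <;> ring
  simp only [key, Finset.sum_add_distrib, Finset.sum_sub_distrib, ← Finset.mul_sum]

/-- The product of an `l`-side kernel (seen through the `l`-side typed edges) and an `h`-side
kernel (seen through the `h`-side typed edges). -/
def rprod (L₁ L₂ : Finset E) (z : Config E) (KL KH : Config E → Config E → Config E → R) :
    Config E → Config E → Config E → R :=
  fun x y w => KL (restr L₁ z x) (restr L₁ z y) (restr L₁ z w) *
    KH (restr L₂ z x) (restr L₂ z y) (restr L₂ z w)

/-- The typed count of `rprod` over disjoint sides factorises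
(`TypedFactor.typedCount_mul_of_disjoint`). -/
lemma typedCount_rprod {L₁ L₂ : Finset E} (hd : Disjoint L₁ L₂) (z : Config E) (τ : E → ℕ)
    (KL KH : Config E → Config E → Config E → R) :
    typedCount (L₁ ∪ L₂) z τ (rprod L₁ L₂ z KL KH) =
      typedCount L₁ z τ KL * typedCount L₂ z τ KH :=
  typedCount_mul_of_disjoint L₁ L₂ hd z τ KL KH

/-- A kernel seen through a subset `A ⊆ F` of the typed edges: the count over `F` is the count
over `A` times the count of the inert edges `F \ A` (a positive constant). -/
lemma typedCount_eq_mul_inert {A F : Finset E} (hAF : A ⊆ F) (z : Config E) (τ : E → ℕ)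
    (KA : Config E → Config E → Config E → R) :
    typedCount F z τ (fun x y w => KA (restr A z x) (restr A z y) (restr A z w)) =
      typedCount A z τ KA * typedCount (F \ A) z τ (fun _ _ _ => (1 : R)) := by
  have h := typedCount_mul_of_disjoint A (F \ A) Finset.disjoint_sdiff z τ KA
    (fun _ _ _ => (1 : R))
  rw [Finset.union_sdiff_of_subset hAF] at h
  rw [← h]
  exact typedCount_congr' _ _ _ _ _ fun x y w => (mul_one _).symm

end Factor

end Separated

end CovForm

end Summit.Ventures.PercRepro2

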